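import Literature.AlgebraicGeometry.HodgeTheory.AbelianVarietySubvarietyIsotypicPieces
import HarnessLib

/-!
# The isotypic pieces of abelian subvarieties are functorial: every homomorphism `φ : Z → Z'` between abelian
# subvarieties of `X` maps the piece `Z_q = u_q(Z)` into `Z'_q = u_q(Z')`, so `φ` is block-diagonal along
# `⨁_q Z_q → Z`, `⨁_q Z'_q → Z'`; the pieces are monotone in `Z`, isotypic (`u_q(Z_q) = Z_q`, `u_{q'}(Z_q) = 0`), and the
# pieces of `X` are the components (Mumford §19 Cor. 1–2; Silverberg–Zarhin 2015 §3; Lange–Rodríguez Thm. 2.9.1)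

Layer `Literature/AlgebraicGeometry/HodgeTheory`; theorems only (no `def`, no instance, no named fact; net debt 0).  Sequel of
`…SubvarietyIsotypicPieces` in the same setting: over ANY field, a `Hom`-orthogonal system of abelian subvarieties
`i_q : Y_q ↪ X` whose addition map `desc i` is an isogeny with quasi-inverse `v` (`desc i ≫ v = m • 𝟙`, `m ≠ 0`), the central
isotypic projectors `u_q = (v ≫ π_q) ≫ i_q`, an abelian subvariety `j : Z ↪ X` with a quasi-retraction (`j ≫ h = N • 𝟙`,
`N ≠ 0`), its pieces `Z_q = im(j ≫ u_q)` with their inclusions `a_q : Z_q ↪ Z` (`a_q ≫ j = im(j ≫ u_q) ↪ X`); §2 discharges the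
orthogonality and the quasi-retraction over a PERFECT field.

THE PRINT.  Mumford, *Abelian Varieties* §19 Cor. 1–2 of Thm. 1 (pp. 173–174): the decomposition `X ∼ ∏ X_i^{n_i}` and
`End⁰(X) = ⊕_i M_{n_i}(D_i)` — homomorphisms respect the isotypic blocks since `Hom(X_i^{n_i}, X_k^{n_k}) = 0` for `i ≠ k`;
Silverberg–Zarhin 2015 (held `paper:arxiv-1409.0592`) Def. 2.3 (p. 3: an isotypic component is a MAXIMAL isotypic abelian
subvariety) and proof of Lemma 3.3 (p. 5: `Hom_F(X, Y) = 0` for distinct components, `End⁰(A) = ⊕ End⁰(X)`); Lange–Rodríguez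
2022 Thm. 2.9.1 (PDF p. 43: `Hom_G(A^{e_i}, A^{e_j}) = 0` for `i ≠ j`, the addition map an isogeny).  Functoriality is the
standard consequence: `φ(Z_q)` is an abelian subvariety of `Z'` of type `B_q`, hence inside the maximal one `Z'_q`; the
proof below is choice-free and works over any field — `Z_q = h(Y_q)` (`exists_surjective_comp_isotypicPiece_eq`), and for
`α := h ≫ φ ≫ j' ∈ Hom(X, X)` one has `m · (i_q ≫ α) = (i_q ≫ u_q) ≫ α = i_q ≫ α ≫ u_q` by CENTRALITY of `u_q`, whose range lies
in `u_q(Z')`.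

Results (namespace `Literature.AlgebraicGeometry.HodgeTheory.AbelianVariety`):
* §1 (any field) `range_comp_isotypicProjector_mono` (`Z ⊆ Z' ⟹ Z_q ⊆ Z'_q`), `range_component_comp_isotypicProjector_self`
  (`u_q(Y_q) = Y_q`: the pieces of `X` are the components), `range_isotypicPiece_comp_isotypicProjector_self` (`u_q(Z_q) = Z_q`),
  `isotypicPiece_comp_isotypicProjector_ne` (`u_{q'}` kills `Z_q`), **`range_comp_comp_subset_range_comp_isotypicProjector`**
  (`φ(Z_q) ⊆ Z'_q` for EVERY `φ : Z → Z'` and every `j' : Z' → X`), **`existsUnique_restrict_isotypicPieces`** (the unique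
  restriction `φ_q : Z_q → Z'_q`, `φ_q ≫ a'_q = a_q ≫ φ`), **`exists_desc_comp_eq_map_comp_desc_isotypicPieces`** (block-diagonal
  form `desc a ≫ φ = (⊕_q φ_q) ≫ desc a'`);
* §2 (perfect field; isotypic components `Y_q ∼ B_q^{n_q+1}`) `existsUnique_restrict_isotypicPieces_of_isotypicComponents`,
  `exists_desc_comp_eq_map_comp_desc_isotypicPieces_of_isotypicComponents`.

## References
* [MumfordAV1970] D. Mumford, *Abelian Varieties* (1970), §19 Thm. 1, Remark p. 169, Cor. 1–2 (pp. 169–174).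
* [SilverbergZarhin2015] A. Silverberg, Yu. G. Zarhin, *Isogenies of abelian varieties over finite fields*, Des. Codes Cryptogr. 77
  (2015) (arXiv:1409.0592), Def. 2.2–2.3 (p. 3), Lemma 3.3 and its proof (p. 5).
* [LangeRodriguez2022] H. Lange, R. E. Rodríguez, *Decomposition of Jacobians by Prym Varieties*, LNM 2310 (2022), §2.9 Thm. 2.9.1
  (PDF p. 43).
* [GortzWedhorn2020] U. Görtz, T. Wedhorn, *Algebraic Geometry I: Schemes*, 2nd ed. (2020), Prop. 4.32 (PDF p. 137), Remark 10.32
  (PDF p. 312), Cor. 16.56 (1) (PDF p. 678).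
-/

noncomputable section

universe u

open CategoryTheory CategoryTheory.Limits

namespace Literature.AlgebraicGeometry.HodgeTheory

namespace AbelianVariety

open _root_.AlgebraicGeometry
open Literature.AlgebraicGeometry.Motives Literature.AlgebraicGeometry.Motives.AbelianVariety

variable {K : Type u} [Field K]

/-! ## §1 Monotonicity, isotypy and functoriality of the pieces (any field) -/

section AnyField

variable {Q : Type} [Fintype Q] {X Z Z' : Motives.AbelianVariety K} {Y : Q → Motives.AbelianVariety K} (i : ∀ q, Y q ⟶ X)
  {v : X ⟶ ⨁ Y} {m : ℕ} (j : Z ⟶ X) (j' : Z' ⟶ X)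

/-- **Monotonicity**: `Z ⊆ Z'` (a factorisation `g ≫ j' = j`) ⟹ `u_q(Z) ⊆ u_q(Z')`. [cite: SilverbergZarhin2015, Def. 2.3 (p. 3)]
[cite: GortzWedhorn2020, Remark 10.32 (PDF p. 312)] -/
theorem range_comp_isotypicProjector_mono (g : Z ⟶ Z') (hg : g ≫ j' = j) (q : Q) :
    Set.range (Hom.toSchemeHom (j ≫ (v ≫ biproduct.π Y q) ≫ i q)) ⊆
      Set.range (Hom.toSchemeHom (j' ≫ (v ≫ biproduct.π Y q) ≫ i q)) := by
  rw [← hg, Category.assoc g j']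
  exact range_toSchemeHom_comp_subset g _

/-- **The pieces of `X` are the components**: `u_q(Y_q) = Y_q`, i.e. `range (i_q ≫ u_q) = range i_q` (`i_q ≫ u_q = m • i_q`,
`m ≠ 0`). [cite: MumfordAV1970, §19 Cor. 2 of Thm. 1 (p. 174)] [cite: LangeRodriguez2022, §2.9 (PDF p. 43: `A^{e_i} = Im(m e_i)`)] -/
theorem range_component_comp_isotypicProjector_self (hdv : biproduct.desc i ≫ v = m • 𝟙 (⨁ Y)) (hm : m ≠ 0)
    (q : Q) : Set.range (Hom.toSchemeHom (i q ≫ (v ≫ biproduct.π Y q) ≫ i q)) = Set.range (Hom.toSchemeHom (i q)) := by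
  have e : i q ≫ ((v ≫ biproduct.π Y q) ≫ i q) = (m • 𝟙 (Y q)) ≫ i q := by
    rw [comp_isotypicProjector_self i hdv q, Preadditive.nsmul_comp, Category.id_comp]
  haveI : Surjective (Hom.toSchemeHom (m • 𝟙 (Y q))) := (isIsogeny_nsmul_id (Y q) hm).1
  rw [e, range_toSchemeHom_comp_eq_of_surjective]

/-- **The pieces are isotypic**: `u_q(Z_q) = Z_q`, i.e. `range ((Z_q ↪ X) ≫ u_q) = range (Z_q ↪ X)` (`u_q ≫ u_q = m • u_q`).
[cite: MumfordAV1970, §19 Cor. 2 of Thm. 1 (p. 174)] [cite: SilverbergZarhin2015, Def. 2.2–2.3 (p. 3)] -/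
theorem range_isotypicPiece_comp_isotypicProjector_self (hdv : biproduct.desc i ≫ v = m • 𝟙 (⨁ Y)) (hm : m ≠ 0) (q : Q) :
    Set.range (Hom.toSchemeHom (imageι (j ≫ (v ≫ biproduct.π Y q) ≫ i q) ≫ (v ≫ biproduct.π Y q) ≫ i q)) =
      Set.range (Hom.toSchemeHom (imageι (j ≫ (v ≫ biproduct.π Y q) ≫ i q))) := by
  have e : (j ≫ (v ≫ biproduct.π Y q) ≫ i q) ≫ ((v ≫ biproduct.π Y q) ≫ i q) =
      (m • 𝟙 Z) ≫ j ≫ (v ≫ biproduct.π Y q) ≫ i q := by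
    rw [Category.assoc j ((v ≫ biproduct.π Y q) ≫ i q), isotypicProjector_comp_self i hdv q, Preadditive.comp_nsmul,
      Preadditive.nsmul_comp, Category.id_comp]
  haveI : Surjective (Hom.toSchemeHom (m • 𝟙 Z)) := (isIsogeny_nsmul_id Z hm).1
  rw [← range_toSchemeHom_comp_eq_of_surjective (toImage (j ≫ (v ≫ biproduct.π Y q) ≫ i q))
      (imageι (j ≫ (v ≫ biproduct.π Y q) ≫ i q) ≫ (v ≫ biproduct.π Y q) ≫ i q),
    ← Category.assoc (toImage _) (imageι _) ((v ≫ biproduct.π Y q) ≫ i q), toImage_imageι, e,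
    range_toSchemeHom_comp_eq_of_surjective, range_toSchemeHom_imageι]

/-- `u_{q'}(Z_q) = 0` for `q' ≠ q`: `(Z_q ↪ X) ≫ u_{q'} = 0` (`u_q ≫ u_{q'} = 0`). [cite: MumfordAV1970, §19 Cor. 2 of Thm. 1 (p. 174)]
[cite: LangeRodriguez2022, §2.9 Thm. 2.9.1 (a) (PDF p. 43)] -/
theorem isotypicPiece_comp_isotypicProjector_ne (hdv : biproduct.desc i ≫ v = m • 𝟙 (⨁ Y)) {q q' : Q} (hqq' : q ≠ q') :
    imageι (j ≫ (v ≫ biproduct.π Y q) ≫ i q) ≫ ((v ≫ biproduct.π Y q') ≫ i q') = 0 := by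
  haveI := epi_of_surjective_toSchemeHom (toImage (j ≫ (v ≫ biproduct.π Y q) ≫ i q))
  rw [← cancel_epi (toImage (j ≫ (v ≫ biproduct.π Y q) ≫ i q)), comp_zero,
    ← Category.assoc (toImage _) (imageι _) ((v ≫ biproduct.π Y q') ≫ i q'), toImage_imageι,
    Category.assoc j ((v ≫ biproduct.π Y q) ≫ i q), isotypicProjector_comp_ne i hdv hqq', comp_zero]

/-- **FUNCTORIALITY: `φ(Z_q) ⊆ Z'_q` for every homomorphism `φ : Z → Z'`** and every `j' : Z' → X` (any field; `Z ↪ X` with a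
quasi-retraction `h`, pieces `a_q : Z_q ↪ Z`): `range ((a_q ≫ φ) ≫ j') ⊆ range (j' ≫ u_q)`.  With `c_q : Y_q ↠ Z_q`
(`c_q ≫ a_q = i_q ≫ h`) and `α = h ≫ φ ≫ j'`: `m · (i_q ≫ α) = (i_q ≫ u_q) ≫ α = i_q ≫ α ≫ u_q`, and `[m]` is surjective.
[cite: MumfordAV1970, §19 Cor. 2 of Thm. 1 (p. 174)] [cite: SilverbergZarhin2015, Def. 2.3 (p. 3) and proof of Lemma 3.3 (p. 5)]
[cite: LangeRodriguez2022, §2.9 Thm. 2.9.1 (PDF p. 43)] -/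
theorem range_comp_comp_subset_range_comp_isotypicProjector (hi : ∀ q, IsClosedImmersion (Hom.toSchemeHom (i q)))
    (hdesc : IsIsogeny (biproduct.desc i)) (hdv : biproduct.desc i ≫ v = m • 𝟙 (⨁ Y))
    (horth : ∀ q q', q ≠ q' → ∀ f : Y q ⟶ Y q', f = 0) (hm : m ≠ 0) [IsClosedImmersion (Hom.toSchemeHom j)] {h : X ⟶ Z}
    {N : ℕ} (hN : N ≠ 0) (hjh : j ≫ h = N • 𝟙 Z) (a : ∀ q, image (j ≫ (v ≫ biproduct.π Y q) ≫ i q) ⟶ Z)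
    (ha : ∀ q, a q ≫ j = imageι (j ≫ (v ≫ biproduct.π Y q) ≫ i q)) (q : Q) (φ : Z ⟶ Z') :
    Set.range (Hom.toSchemeHom ((a q ≫ φ) ≫ j')) ⊆ Set.range (Hom.toSchemeHom (j' ≫ (v ≫ biproduct.π Y q) ≫ i q)) := by
  obtain ⟨c, hc, hca⟩ := exists_surjective_comp_isotypicPiece_eq i j hi hdesc hdv horth hm hN hjh a ha q
  haveI := hc
  haveI : Surjective (Hom.toSchemeHom (m • 𝟙 (Y q))) := (isIsogeny_nsmul_id (Y q) hm).1
  have key : (m • 𝟙 (Y q)) ≫ c ≫ (a q ≫ φ) ≫ j' = ((i q ≫ h) ≫ φ) ≫ j' ≫ (v ≫ biproduct.π Y q) ≫ i q :=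
    calc (m • 𝟙 (Y q)) ≫ c ≫ (a q ≫ φ) ≫ j'
        = m • (i q ≫ h ≫ φ ≫ j') := by
          rw [Preadditive.nsmul_comp, Category.id_comp, Category.assoc (a q), ← Category.assoc c (a q), hca,
            Category.assoc (i q)]
      _ = (i q ≫ ((v ≫ biproduct.π Y q) ≫ i q)) ≫ (h ≫ φ ≫ j') := by
          rw [comp_isotypicProjector_self i hdv q, Preadditive.nsmul_comp]
      _ = i q ≫ ((h ≫ φ ≫ j') ≫ ((v ≫ biproduct.π Y q) ≫ i q)) := by
          rw [Category.assoc (i q) ((v ≫ biproduct.π Y q) ≫ i q) (h ≫ φ ≫ j'),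
            ← isotypicProjector_comm i hi hdesc hdv horth (h ≫ φ ≫ j') q]
      _ = ((i q ≫ h) ≫ φ) ≫ j' ≫ (v ≫ biproduct.π Y q) ≫ i q := by simp only [Category.assoc]
  rw [← range_toSchemeHom_comp_eq_of_surjective c ((a q ≫ φ) ≫ j'),
    ← range_toSchemeHom_comp_eq_of_surjective (m • 𝟙 (Y q)) (c ≫ (a q ≫ φ) ≫ j'), key]
  exact range_toSchemeHom_comp_subset _ _

/-- **Every homomorphism `φ : Z → Z'` of abelian subvarieties of `X` restricts uniquely to the isotypic pieces**:
`∃! φ_q : Z_q → Z'_q` with `φ_q ≫ a'_q = a_q ≫ φ` (any field; quasi-retraction for `Z`, `j'` a closed immersion).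
[cite: MumfordAV1970, §19 Cor. 2 of Thm. 1 (p. 174)] [cite: SilverbergZarhin2015, proof of Lemma 3.3 (p. 5)]
[cite: GortzWedhorn2020, Remark 10.32 (PDF p. 312) and Cor. 16.56 (1) (PDF p. 678)] -/
theorem existsUnique_restrict_isotypicPieces (hi : ∀ q, IsClosedImmersion (Hom.toSchemeHom (i q)))
    (hdesc : IsIsogeny (biproduct.desc i)) (hdv : biproduct.desc i ≫ v = m • 𝟙 (⨁ Y))
    (horth : ∀ q q', q ≠ q' → ∀ f : Y q ⟶ Y q', f = 0) (hm : m ≠ 0) [IsClosedImmersion (Hom.toSchemeHom j)] {h : X ⟶ Z}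
    {N : ℕ} (hN : N ≠ 0) (hjh : j ≫ h = N • 𝟙 Z) (a : ∀ q, image (j ≫ (v ≫ biproduct.π Y q) ≫ i q) ⟶ Z)
    (ha : ∀ q, a q ≫ j = imageι (j ≫ (v ≫ biproduct.π Y q) ≫ i q)) [IsClosedImmersion (Hom.toSchemeHom j')]
    (a' : ∀ q, image (j' ≫ (v ≫ biproduct.π Y q) ≫ i q) ⟶ Z')
    (ha' : ∀ q, a' q ≫ j' = imageι (j' ≫ (v ≫ biproduct.π Y q) ≫ i q)) (φ : Z ⟶ Z') (q : Q) :
    ∃! φq : image (j ≫ (v ≫ biproduct.π Y q) ≫ i q) ⟶ image (j' ≫ (v ≫ biproduct.π Y q) ≫ i q),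
      φq ≫ a' q = a q ≫ φ := by
  haveI := isClosedImmersion_of_comp_eq_of_isClosedImmersion _ j' (a' q) (ha' q)
  refine existsUnique_hom_comp_eq_of_range_subset (a q ≫ φ) (a' q) ?_
  rw [← Set.image_subset_image_iff (Hom.toSchemeHom j').isClosedEmbedding.injective,
    ← range_toSchemeHom_comp_eq_image, ← range_toSchemeHom_comp_eq_image, ha', range_toSchemeHom_imageι]
  exact range_comp_comp_subset_range_comp_isotypicProjector i j j' hi hdesc hdv horth hm hN hjh a ha q φ

/-- **Block-diagonal form**: every `φ : Z → Z'` is `desc a ≫ φ = (⊕_q φ_q) ≫ desc a'` along the isogenies `⨁_q Z_q → Z`,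
`⨁_q Z'_q → Z'` of `…SubvarietyIsotypicPieces`. [cite: MumfordAV1970, §19 Cor. 2 of Thm. 1 (p. 174: `End⁰(X) = ⊕ M_{n_i}(D_i)`)]
[cite: SilverbergZarhin2015, proof of Lemma 3.3 (p. 5: `End⁰(A) ≅ ⊕ End⁰(X)`)] -/
theorem exists_desc_comp_eq_map_comp_desc_isotypicPieces (hi : ∀ q, IsClosedImmersion (Hom.toSchemeHom (i q)))
    (hdesc : IsIsogeny (biproduct.desc i)) (hdv : biproduct.desc i ≫ v = m • 𝟙 (⨁ Y))
    (horth : ∀ q q', q ≠ q' → ∀ f : Y q ⟶ Y q', f = 0) (hm : m ≠ 0) [IsClosedImmersion (Hom.toSchemeHom j)] {h : X ⟶ Z}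
    {N : ℕ} (hN : N ≠ 0) (hjh : j ≫ h = N • 𝟙 Z) (a : ∀ q, image (j ≫ (v ≫ biproduct.π Y q) ≫ i q) ⟶ Z)
    (ha : ∀ q, a q ≫ j = imageι (j ≫ (v ≫ biproduct.π Y q) ≫ i q)) [IsClosedImmersion (Hom.toSchemeHom j')]
    (a' : ∀ q, image (j' ≫ (v ≫ biproduct.π Y q) ≫ i q) ⟶ Z')
    (ha' : ∀ q, a' q ≫ j' = imageι (j' ≫ (v ≫ biproduct.π Y q) ≫ i q)) (φ : Z ⟶ Z') :
    ∃ φq : ∀ q, image (j ≫ (v ≫ biproduct.π Y q) ≫ i q) ⟶ image (j' ≫ (v ≫ biproduct.π Y q) ≫ i q),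
      (∀ q, φq q ≫ a' q = a q ≫ φ) ∧ biproduct.desc a ≫ φ = biproduct.map φq ≫ biproduct.desc a' := by
  classical
  choose φq hφ _ using existsUnique_restrict_isotypicPieces i j j' hi hdesc hdv horth hm hN hjh a ha a' ha' φ
  exact ⟨φq, hφ, biproduct.hom_ext' _ _ fun q ↦ by
    rw [biproduct.ι_desc_assoc, biproduct.ι_map_assoc, biproduct.ι_desc, hφ]⟩

end AnyField

/-! ## §2 Over a perfect field -/

section Perfect

variable [PerfectField K] {Q : Type} [Fintype Q] {B : Q → Motives.AbelianVariety K} {n : Q → ℕ}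
  {X Z Z' : Motives.AbelianVariety K} {Y : Q → Motives.AbelianVariety K}

/-- Functoriality of the isotypic pieces over a perfect field: for isotypic components `i_q : Y_q ↪ X`, `Y_q ∼ B_q^{n_q+1}`
(`B_q` simple pairwise non-isogenous of positive dimension, addition map an isogeny with quasi-inverse `v`,
`desc i ≫ v = m • 𝟙`, `m ≠ 0`), abelian subvarieties `j : Z ↪ X`, `j' : Z' ↪ X` with piece inclusions `a_q`, `a'_q`, every
`φ : Z → Z'` restricts uniquely, `φ_q ≫ a'_q = a_q ≫ φ`. [cite: MumfordAV1970, §19 Cor. 2 of Thm. 1 (p. 174)]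
[cite: SilverbergZarhin2015, Def. 2.3 (p. 3) and proof of Lemma 3.3 (p. 5)] [cite: Milne1986AbelianVarieties, §12 Prop. 12.1 (PDF p. 189)] -/
theorem existsUnique_restrict_isotypicPieces_of_isotypicComponents (hB : ∀ q, (B q).IsSimple)
    (hB0 : ∀ q, 0 < (B q).dim) (hni : ∀ q q', q ≠ q' → ¬ IsIsogenous (B q) (B q'))
    (hY : ∀ q, IsIsogenous (Y q) (⨁ fun _ : Fin (n q + 1) ↦ B q)) (i : ∀ q, Y q ⟶ X)
    (hi : ∀ q, IsClosedImmersion (Hom.toSchemeHom (i q))) (hdesc : IsIsogeny (biproduct.desc i)) {v : X ⟶ ⨁ Y} {m : ℕ}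
    (hdv : biproduct.desc i ≫ v = m • 𝟙 (⨁ Y)) (hm : m ≠ 0) (j : Z ⟶ X) [IsClosedImmersion (Hom.toSchemeHom j)]
    (a : ∀ q, image (j ≫ (v ≫ biproduct.π Y q) ≫ i q) ⟶ Z) (ha : ∀ q, a q ≫ j = imageι (j ≫ (v ≫ biproduct.π Y q) ≫ i q))
    (j' : Z' ⟶ X) [IsClosedImmersion (Hom.toSchemeHom j')] (a' : ∀ q, image (j' ≫ (v ≫ biproduct.π Y q) ≫ i q) ⟶ Z')
    (ha' : ∀ q, a' q ≫ j' = imageι (j' ≫ (v ≫ biproduct.π Y q) ≫ i q)) (φ : Z ⟶ Z') (q : Q) :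
    ∃! φq : image (j ≫ (v ≫ biproduct.π Y q) ≫ i q) ⟶ image (j' ≫ (v ≫ biproduct.π Y q) ≫ i q),
      φq ≫ a' q = a q ≫ φ := by
  obtain ⟨h, N, hN, hjh⟩ := exists_quasiRetraction_of_perfectField j
  exact existsUnique_restrict_isotypicPieces i j j' hi hdesc hdv (fun q q' hqq' f ↦
    hom_eq_zero_of_isIsogenous_biproduct_const_of_ne hB hB0 hni hqq' (hY q) (hY q') f) hm hN hjh a ha a' ha' φ q

/-- Block-diagonal form of every `φ : Z → Z'` along the isotypic pieces, over a perfect field.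
[cite: MumfordAV1970, §19 Cor. 2 of Thm. 1 (p. 174)] [cite: SilverbergZarhin2015, proof of Lemma 3.3 (p. 5)] -/
theorem exists_desc_comp_eq_map_comp_desc_isotypicPieces_of_isotypicComponents (hB : ∀ q, (B q).IsSimple)
    (hB0 : ∀ q, 0 < (B q).dim) (hni : ∀ q q', q ≠ q' → ¬ IsIsogenous (B q) (B q'))
    (hY : ∀ q, IsIsogenous (Y q) (⨁ fun _ : Fin (n q + 1) ↦ B q)) (i : ∀ q, Y q ⟶ X)
    (hi : ∀ q, IsClosedImmersion (Hom.toSchemeHom (i q))) (hdesc : IsIsogeny (biproduct.desc i)) {v : X ⟶ ⨁ Y} {m : ℕ}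
    (hdv : biproduct.desc i ≫ v = m • 𝟙 (⨁ Y)) (hm : m ≠ 0) (j : Z ⟶ X) [IsClosedImmersion (Hom.toSchemeHom j)]
    (a : ∀ q, image (j ≫ (v ≫ biproduct.π Y q) ≫ i q) ⟶ Z) (ha : ∀ q, a q ≫ j = imageι (j ≫ (v ≫ biproduct.π Y q) ≫ i q))
    (j' : Z' ⟶ X) [IsClosedImmersion (Hom.toSchemeHom j')] (a' : ∀ q, image (j' ≫ (v ≫ biproduct.π Y q) ≫ i q) ⟶ Z')
    (ha' : ∀ q, a' q ≫ j' = imageι (j' ≫ (v ≫ biproduct.π Y q) ≫ i q)) (φ : Z ⟶ Z') :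
    ∃ φq : ∀ q, image (j ≫ (v ≫ biproduct.π Y q) ≫ i q) ⟶ image (j' ≫ (v ≫ biproduct.π Y q) ≫ i q),
      (∀ q, φq q ≫ a' q = a q ≫ φ) ∧ biproduct.desc a ≫ φ = biproduct.map φq ≫ biproduct.desc a' := by
  obtain ⟨h, N, hN, hjh⟩ := exists_quasiRetraction_of_perfectField j
  exact exists_desc_comp_eq_map_comp_desc_isotypicPieces i j j' hi hdesc hdv (fun q q' hqq' f ↦
    hom_eq_zero_of_isIsogenous_biproduct_const_of_ne hB hB0 hni hqq' (hY q) (hY q') f) hm hN hjh a ha a' ha' φ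

end Perfect

end AbelianVariety

end Literature.AlgebraicGeometry.HodgeTheory

end
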